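import Summits.Ventures.Crystal3D.Theorems.StickyWulffConstantStackingLiminfKernelBounds
import Summits.Ventures.Crystal3D.Theorems.StickyWulffConstantStackingLiminfLatticeSumLower
import Summits.Ventures.Crystal3D.Theorems.StickyWulffConstantStackingLiminfRungBumpMass
import Summits.Ventures.Crystal3D.Theorems.StickyWulffConstantStackingLiminfRungEtaMass
import HarnessLib

/-!
# Vacancy density for line `LayerChain` v4 (crux `StackingLiminf`, stmt-Ventures-19145): below the
# plateau, many lattice sites nearby are VACANT

Route `StickyWulffConstant` of the venture `Summits/Ventures/Crystal3D` (cell `crystal3d-full`).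
With the one-site kernel `κ_p = smooth (fun _ => p) K L` (`…KernelBounds`) and a finite set `F` of
lattice indices of the stacking `barlowStacking 1 √(2/3) σ` containing every index whose point is within
`K` of some point of the lateral `L`-window of `y`:
* `one_sub_le_sum_smooth_single` — the FULL mollified density is `≥ 1 − 96√2·bumpConst/K` at `y`
  (lower lattice bound `…LatticeSumLower` averaged against `η_L ≥ 0`, masses R1/R2);
* `sum_smooth_single_split` — `Σ_{t ∈ F} κ_{P_t} = smooth x K L + Σ_{t ∈ F, vacant} κ_{P_t}` for a
  configuration `x` indexed inside `F`;
* `vacant_sum_le_card_mul` — the vacant part is `≤ (16 bumpConst/(π L² K)) · #{vacant t ∈ F near y}`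
  (kernel height + support);
* **`card_vacant_near_ge`** — hence, if `smooth x K L y ≤ 1 − θ` and `96√2·bumpConst/K ≤ θ/2`, at least
  `(θ/2)·π L² K/(16 bumpConst)` indices `t ∈ F ∖ idx(X)` have `|y₂ − (P_t)₂| < K`,
  `|y₀ − (P_t)₀|, |y₁ − (P_t)₁| < K + L`.
This is the "vacancy" half of the bad-mass step of stub (C) `stub_plateauBound`; the other half is the
pair count (`…GridPairCount`, `…GridBoundary`).
WHAT THIS IS NOT: not stub (C); rung F-C1 not moved.
-/

noncomputable section

namespace Summit.Ventures.Crystal3D.Theorems.PlateauHeight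

open MeasureTheory Metric
open Literature.MathematicalPhysics.StatisticalMechanics (barlowPos barlowStacking)
open Summit.Ventures.Crystal3D.Cruxes.StackingLiminf.LayerChainV4 (bump bumpConst dens eta smooth)
open Summit.Ventures.Crystal3D.LayerChain (dot3)

/-- **Full-lattice lower bound, laterally averaged.**  If `F` contains every lattice index whose
point is within Euclidean distance `K` of some `y − ιζ` with `|ζ₁|, |ζ₂| < L`, then
`1 − 96√2·bumpConst/K ≤ Σ_{t ∈ F} κ_{P_t}(y)`. -/
theorem one_sub_le_sum_smooth_single (σ : ℤ → ℤ) {K L : ℝ} (hK : 1 ≤ K) (hL : 0 < L)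
    (y : Fin 3 → ℝ) (F : Finset (ℤ × ℤ × ℤ))
    (hF : ∀ ζ : ℝ × ℝ, |ζ.1| < L → |ζ.2| < L → ∀ k i j : ℤ,
      Real.sqrt (dot3
        ((fun l => y l - (![ζ.1, ζ.2, 0] : Fin 3 → ℝ) l) -
          WithLp.ofLp (barlowPos 1 (Real.sqrt (2 / 3)) σ k i j))
        ((fun l => y l - (![ζ.1, ζ.2, 0] : Fin 3 → ℝ) l) -
          WithLp.ofLp (barlowPos 1 (Real.sqrt (2 / 3)) σ k i j))) < K → (k, i, j) ∈ F) :
    1 - 96 * Real.sqrt 2 * bumpConst / K ≤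
      ∑ t ∈ F, smooth (fun _ : Fin 1 => barlowPos 1 (Real.sqrt (2 / 3)) σ t.1 t.2.1 t.2.2) K L y := by
  have hK0 : 0 < K := by linarith
  -- each summand as an integral against `η_L`
  unfold smooth
  simp_rw [dens_single]
  have hcont : ∀ t : ℤ × ℤ × ℤ, Continuous fun z : ℝ × ℝ =>
      bump K (fun j => y j - (![z.1, z.2, 0] : Fin 3 → ℝ) j -
        (barlowPos 1 (Real.sqrt (2 / 3)) σ t.1 t.2.1 t.2.2) j) := fun t =>
    (continuous_bump K).comp (continuous_pi fun j => by fin_cases j <;> simp <;> fun_prop)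
  rw [← integral_finsetSum _ fun t _ => integrable_eta_mul hL (hcont t)]
  -- compare with `∫ η_L · (1 − C/K)`
  have hmass : ∫ z : ℝ × ℝ, eta L z * (1 - 96 * Real.sqrt 2 * bumpConst / K) =
      1 - 96 * Real.sqrt 2 * bumpConst / K := by
    rw [integral_mul_const, rung_integral_eta L hL, one_mul]
  rw [← hmass]
  refine integral_mono ((integrable_eta_mul hL continuous_const)) ?_ fun z => ?_
  · have := integrable_finsetSum F fun t (_ : t ∈ F) => integrable_eta_mul hL (hcont t)
    exact this
  · -- pointwise: either `η_L(z) = 0`, or the lower lattice bound applies at `y − ιz`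
    simp only
    rw [← Finset.mul_sum]
    by_cases hz : L ≤ |z.1| ∨ L ≤ |z.2|
    · rw [eta_eq_zero_of_coord hL hz, zero_mul, zero_mul]
    · rw [not_or, not_le, not_le] at hz
      refine mul_le_mul_of_nonneg_left ?_ (eta_nonneg L z)
      have h := sqrt_two_mul_integral_bump_sub_le_sum σ hK
        (fun l => y l - (![z.1, z.2, 0] : Fin 3 → ℝ) l) F (hF z hz.1 hz.2)
      rw [rung_integral_bump K hK0] at h
      have e : Real.sqrt 2 * (1 / Real.sqrt 2) = 1 := by
        have : 0 < Real.sqrt 2 := Real.sqrt_pos.2 (by norm_num)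
        field_simp
      rw [e] at h
      refine h.trans (le_of_eq (Finset.sum_congr rfl fun t _ => ?_))
      rfl

/-- **Occupied/vacant split.**  For a configuration `x` indexed by `idx` with `idx(X) ⊆ F`:
`Σ_{t ∈ F} κ_{P_t}(y) = smooth x K L y + Σ_{t ∈ F, t ∉ idx(X)} κ_{P_t}(y)`. -/
theorem sum_smooth_single_split (σ : ℤ → ℤ) {N : ℕ} (x : Fin N → EuclideanSpace ℝ (Fin 3))
    (idx : Fin N → ℤ × ℤ × ℤ) (hinj : Function.Injective idx)
    (hidx : ∀ i, x i = barlowPos 1 (Real.sqrt (2 / 3)) σ (idx i).1 (idx i).2.1 (idx i).2.2)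
    (F : Finset (ℤ × ℤ × ℤ)) (hsub : Finset.univ.image idx ⊆ F) {K L : ℝ} (hL : 0 < L) (y : Fin 3 → ℝ) :
    ∑ t ∈ F, smooth (fun _ : Fin 1 => barlowPos 1 (Real.sqrt (2 / 3)) σ t.1 t.2.1 t.2.2) K L y =
      smooth x K L y + ∑ t ∈ F.filter (fun t => t ∉ Finset.univ.image idx),
        smooth (fun _ : Fin 1 => barlowPos 1 (Real.sqrt (2 / 3)) σ t.1 t.2.1 t.2.2) K L y := by
  classical
  rw [← Finset.sum_filter_add_sum_filter_not F (fun t => t ∈ Finset.univ.image idx)]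
  congr 1
  have hfilt : F.filter (fun t => t ∈ Finset.univ.image idx) = Finset.univ.image idx := by
    ext t
    rw [Finset.mem_filter]
    constructor
    · exact fun h => h.2
    · exact fun h => ⟨hsub h, h⟩
  rw [hfilt, Finset.sum_image fun a _ b _ hab => hinj hab, smooth_eq_sum_single x hL y]
  refine Finset.sum_congr rfl fun i _ => ?_
  rw [← hidx i]

/-- **The vacant part is controlled by the number of vacant sites near `y`.** -/
theorem vacant_sum_le_card_mul (σ : ℤ → ℤ) (V : Finset (ℤ × ℤ × ℤ)) {K L : ℝ} (hK : 0 < K)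
    (hL : 0 < L) (y : Fin 3 → ℝ) :
    ∑ t ∈ V, smooth (fun _ : Fin 1 => barlowPos 1 (Real.sqrt (2 / 3)) σ t.1 t.2.1 t.2.2) K L y ≤
      ((V.filter fun t =>
          |y 2 - (barlowPos 1 (Real.sqrt (2 / 3)) σ t.1 t.2.1 t.2.2) 2| < K ∧
          |y 0 - (barlowPos 1 (Real.sqrt (2 / 3)) σ t.1 t.2.1 t.2.2) 0| < K + L ∧
          |y 1 - (barlowPos 1 (Real.sqrt (2 / 3)) σ t.1 t.2.1 t.2.2) 1| < K + L).card : ℝ) *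
        (16 * bumpConst / (Real.pi * L ^ 2 * K)) := by
  classical
  set near : ℤ × ℤ × ℤ → Prop := fun t =>
    |y 2 - (barlowPos 1 (Real.sqrt (2 / 3)) σ t.1 t.2.1 t.2.2) 2| < K ∧
    |y 0 - (barlowPos 1 (Real.sqrt (2 / 3)) σ t.1 t.2.1 t.2.2) 0| < K + L ∧
    |y 1 - (barlowPos 1 (Real.sqrt (2 / 3)) σ t.1 t.2.1 t.2.2) 1| < K + L with hnear
  rw [← Finset.sum_filter_add_sum_filter_not V near]
  have hfar : ∑ t ∈ V.filter (fun t => ¬near t),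
      smooth (fun _ : Fin 1 => barlowPos 1 (Real.sqrt (2 / 3)) σ t.1 t.2.1 t.2.2) K L y = 0 := by
    refine Finset.sum_eq_zero fun t ht => ?_
    rw [Finset.mem_filter] at ht
    have h := ht.2
    simp only [hnear, not_and_or, not_lt] at h
    rcases h with h | h | h
    · exact smooth_single_eq_zero_of_height _ hK L h
    · exact smooth_single_eq_zero_of_lateral _ hK hL (Or.inl h)
    · exact smooth_single_eq_zero_of_lateral _ hK hL (Or.inr h)
  rw [hfar, add_zero]
  calc ∑ t ∈ V.filter near,
        smooth (fun _ : Fin 1 => barlowPos 1 (Real.sqrt (2 / 3)) σ t.1 t.2.1 t.2.2) K L y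
      ≤ ∑ t ∈ V.filter near, 16 * bumpConst / (Real.pi * L ^ 2 * K) :=
        Finset.sum_le_sum fun t _ => smooth_single_le _ hK hL y
    _ = _ := by rw [Finset.sum_const, nsmul_eq_mul]

/-- **Below the plateau, many nearby sites are vacant.**  If `F ⊇ idx(X)` contains the lattice indices
near the lateral window of `y`, `smooth x K L y ≤ 1 − θ` and `96√2·bumpConst/K ≤ θ/2`, then
`(θ/2) · (π L² K)/(16 bumpConst) ≤ #{t ∈ F ∖ idx(X) : |y₂ − (P_t)₂| < K, |y₀−(P_t)₀|, |y₁−(P_t)₁| < K+L}`. -/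
theorem card_vacant_near_ge (σ : ℤ → ℤ) {N : ℕ} (x : Fin N → EuclideanSpace ℝ (Fin 3))
    (idx : Fin N → ℤ × ℤ × ℤ) (hinj : Function.Injective idx)
    (hidx : ∀ i, x i = barlowPos 1 (Real.sqrt (2 / 3)) σ (idx i).1 (idx i).2.1 (idx i).2.2)
    (F : Finset (ℤ × ℤ × ℤ)) (hsub : Finset.univ.image idx ⊆ F) {K L : ℝ} (hK : 1 ≤ K) (hL : 0 < L)
    (y : Fin 3 → ℝ)
    (hF : ∀ ζ : ℝ × ℝ, |ζ.1| < L → |ζ.2| < L → ∀ k i j : ℤ,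
      Real.sqrt (dot3
        ((fun l => y l - (![ζ.1, ζ.2, 0] : Fin 3 → ℝ) l) -
          WithLp.ofLp (barlowPos 1 (Real.sqrt (2 / 3)) σ k i j))
        ((fun l => y l - (![ζ.1, ζ.2, 0] : Fin 3 → ℝ) l) -
          WithLp.ofLp (barlowPos 1 (Real.sqrt (2 / 3)) σ k i j))) < K → (k, i, j) ∈ F)
    {θ : ℝ} (hθK : 96 * Real.sqrt 2 * bumpConst / K ≤ θ / 2) (hw : smooth x K L y ≤ 1 - θ) :
    θ / 2 * (Real.pi * L ^ 2 * K / (16 * bumpConst)) ≤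
      (((F.filter fun t => t ∉ Finset.univ.image idx).filter fun t =>
          |y 2 - (barlowPos 1 (Real.sqrt (2 / 3)) σ t.1 t.2.1 t.2.2) 2| < K ∧
          |y 0 - (barlowPos 1 (Real.sqrt (2 / 3)) σ t.1 t.2.1 t.2.2) 0| < K + L ∧
          |y 1 - (barlowPos 1 (Real.sqrt (2 / 3)) σ t.1 t.2.1 t.2.2) 1| < K + L).card : ℝ) := by
  have hK0 : 0 < K := by linarith
  have hb := bumpConst_pos
  have h1 := one_sub_le_sum_smooth_single σ hK hL y F hF
  rw [sum_smooth_single_split σ x idx hinj hidx F hsub hL y] at h1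
  have h2 := vacant_sum_le_card_mul σ (F.filter fun t => t ∉ Finset.univ.image idx) hK0 hL y
  -- the vacant sum is at least `θ/2`
  have h3 : θ / 2 ≤ ∑ t ∈ F.filter (fun t => t ∉ Finset.univ.image idx),
      smooth (fun _ : Fin 1 => barlowPos 1 (Real.sqrt (2 / 3)) σ t.1 t.2.1 t.2.2) K L y := by
    linarith
  have hpos : 0 < 16 * bumpConst / (Real.pi * L ^ 2 * K) := by positivity
  have h4 := (div_le_iff₀ hpos).2 (h3.trans h2)
  calc θ / 2 * (Real.pi * L ^ 2 * K / (16 * bumpConst))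
      = θ / 2 / (16 * bumpConst / (Real.pi * L ^ 2 * K)) := by
        field_simp
    _ ≤ _ := h4

end Summit.Ventures.Crystal3D.Theorems.PlateauHeight

end
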